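import Mathlib
import Literature.NumberTheory.Transcendental.GammaFields
import Summits.Schanuel.Schanuel.Theorems.RigidCoreAclSubsetLogFreeCoreCaseIILaurent

/-!
# Case II core, file 6c: the denominator of a semi-invariant fraction is semi-invariant
(registered stub `stub_caseII_denominator` of line `eac-extends-core-automorphisms`,
crux stmt-Schanuel-0968 `Summit.Schanuel.Schanuel.Theses.RigidCore.AclSubsetLogFreeCore`)

Setting of `…CaseIILaurent`: a subfield `k ≤ E` of an exponential field, `ℚ`-subspaces `Y' ≤ Y''`
with `exp Y' ⊆ k`, a tuple `b` of `Y''` spanning it modulo `Y'`, level-`N` coordinates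
`t i = exp ((1/N) • b i)` algebraically independent over `k`, `ev_N = MvPolynomial.aeval t`.
The "Laurent ring" `R = k[exp Y''] = ⋃_N k[t, t⁻¹]` has as units exactly the monomials `c * exp y`
(`c ∈ kˣ`, `y ∈ Y''`), and an exponential automorphism `θ` with `θ k = k`, `θ Y'' = Y''` is an
automorphism of `R` (it moves levels).

* `laurent_mul_denominator` — the DENOMINATOR IDEAL: if `z = ev_N P / ev_N Q` in lowest terms and
  `x`, `z * x` are both Laurent polynomials, then `x ∈ ev_N Q · R`.
* `aeval_eq_const_mul_exp_of_mul_laurent` — a polynomial value `ev_L G` dividing a unit `exp y` in `R`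
  is a monomial `c * exp y'`.
* **`stub_caseII_denominator`** — if moreover `z` is SEMI-INVARIANT, `θ z = (c₀ * exp y₀) * z`, then so
  is its reduced denominator: `θ (ev_N Q) = (c * exp y) * ev_N Q` with `c ∈ kˣ`, `y ∈ Y''`.
  (Apply the denominator ideal to `θ` and to `θ⁻¹`, apply `θ` to the second relation and cancel
  `ev_N Q`: the cofactor of the first relation divides a unit.)
-/

noncomputable section

set_option linter.dupNamespace false

open Set
open scoped BigOperators
open Literature.ModelTheory.ExponentialFields Literature.ModelTheory.ExponentialFields.ExponentialRing
open Literature.NumberTheory.Transcendental Literature.NumberTheory.Transcendental.GammaField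

namespace Summit.Schanuel.Schanuel.Theorems.RigidCore

namespace CaseIICore

variable {E : Type*} [Field E] [CharZero E] [ExponentialRing E]

/-! ### The denominator ideal of a reduced fraction -/

/-- A Laurent presentation at level `N₁` persists at every positive multiple `L` of `N₁`
(with numerator `expand e F`, `L = N₁ e`). [folklore] -/
theorem laurent_dvd (k : Subfield E) {p : ℕ} (b : Fin p → E) {N₁ L : ℕ} (hN₁ : 0 < N₁) (hL : 0 < L)
    (hdvd : N₁ ∣ L) {x : E} {F : MvPolynomial (Fin p) k} {M : Fin p →₀ ℕ}
    (h : x * MvPolynomial.aeval (fun i => exp ((1 / (N₁ : ℚ)) • b i)) (MvPolynomial.monomial M (1 : k)) =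
      MvPolynomial.aeval (fun i => exp ((1 / (N₁ : ℚ)) • b i)) F) :
    ∃ (e : ℕ) (M' : Fin p →₀ ℕ),
      x * MvPolynomial.aeval (fun i => exp ((1 / (L : ℚ)) • b i)) (MvPolynomial.monomial M' (1 : k)) =
        MvPolynomial.aeval (fun i => exp ((1 / (L : ℚ)) • b i)) (MvPolynomial.expand e F) := by
  obtain ⟨e, rfl⟩ := hdvd
  exact ⟨e, e • M, laurent_level k b hN₁ (pos_of_mul_pos_right hL (Nat.zero_le _)) h⟩

/-- **The denominator ideal.**  Let `z * ev_N Q = ev_N P` with `P`, `Q` coprime.  If `x` and `z * x`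
are both Laurent polynomials, then `x` lies in the ideal generated by `ev_N Q` in the Laurent ring:
`x * ev_L (X^M) = ev_N Q * ev_L G` at some level `L`.  (At a common level `L = N e`:
`P^(e) · F_x · X^* = F_{zx} · Q^(e) · X^*` in `k[X]` by injectivity of `ev_L`, and `Q^(e)` is still
prime to `P^(e)`.) [folklore] -/
theorem laurent_mul_denominator (k : Subfield E) {p : ℕ} (b : Fin p → E)
    (hAI : ∀ N : ℕ, 0 < N → AlgebraicIndependent k (fun i => exp ((1 / (N : ℚ)) • b i)))
    (hEC : ∀ {e : ℕ}, 0 < e → ∀ {P Q : MvPolynomial (Fin p) k}, IsRelPrime P Q →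
      IsRelPrime (MvPolynomial.expand e P) (MvPolynomial.expand e Q))
    {N : ℕ} (hN : 0 < N) {z : E} {P Q : MvPolynomial (Fin p) k} (hrel : IsRelPrime P Q)
    (hz : z * MvPolynomial.aeval (fun i => exp ((1 / (N : ℚ)) • b i)) Q =
      MvPolynomial.aeval (fun i => exp ((1 / (N : ℚ)) • b i)) P)
    {x : E}
    (hx : ∃ N₁ : ℕ, 0 < N₁ ∧ ∃ (F : MvPolynomial (Fin p) k) (M : Fin p →₀ ℕ),
      x * MvPolynomial.aeval (fun i => exp ((1 / (N₁ : ℚ)) • b i)) (MvPolynomial.monomial M (1 : k)) =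
        MvPolynomial.aeval (fun i => exp ((1 / (N₁ : ℚ)) • b i)) F)
    (hzx : ∃ N₂ : ℕ, 0 < N₂ ∧ ∃ (F : MvPolynomial (Fin p) k) (M : Fin p →₀ ℕ),
      (z * x) * MvPolynomial.aeval (fun i => exp ((1 / (N₂ : ℚ)) • b i)) (MvPolynomial.monomial M (1 : k)) =
        MvPolynomial.aeval (fun i => exp ((1 / (N₂ : ℚ)) • b i)) F) :
    ∃ L : ℕ, 0 < L ∧ ∃ (G : MvPolynomial (Fin p) k) (M : Fin p →₀ ℕ),
      x * MvPolynomial.aeval (fun i => exp ((1 / (L : ℚ)) • b i)) (MvPolynomial.monomial M (1 : k)) =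
        MvPolynomial.aeval (fun i => exp ((1 / (N : ℚ)) • b i)) Q *
          MvPolynomial.aeval (fun i => exp ((1 / (L : ℚ)) • b i)) G := by
  obtain ⟨N₁, hN₁, F₁, M₁, h₁⟩ := hx
  obtain ⟨N₂, hN₂, F₂, M₂, h₂⟩ := hzx
  have he : 0 < N₁ * N₂ := Nat.mul_pos hN₁ hN₂
  have hL : 0 < N * (N₁ * N₂) := Nat.mul_pos hN he
  obtain ⟨e₁, M₁', h₁'⟩ := laurent_dvd k b hN₁ hL ((dvd_mul_right N₁ N₂).mul_left N) h₁
  obtain ⟨e₂, M₂', h₂'⟩ := laurent_dvd k b hN₂ hL ((dvd_mul_left N₂ N₁).mul_left N) h₂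
  have hz' := fraction_level k b hN he hz
  have hQ' := aeval_expand k b hN he Q
  -- the key identity in `k[X]` at level `L = N (N₁ N₂)`
  have hkey : MvPolynomial.expand (N₁ * N₂) P * (MvPolynomial.expand e₁ F₁ * MvPolynomial.monomial M₂' 1) =
      MvPolynomial.expand (N₁ * N₂) Q * (MvPolynomial.expand e₂ F₂ * MvPolynomial.monomial M₁' 1) := by
    apply aeval_injective k b hAI hL
    simp only [map_mul]
    rw [← hz', ← h₁', ← h₂']
    ring
  obtain ⟨G, hG⟩ : MvPolynomial.expand (N₁ * N₂) Q ∣ MvPolynomial.expand e₁ F₁ * MvPolynomial.monomial M₂' 1 :=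
    (hEC he hrel).symm.dvd_of_dvd_mul_left ⟨_, hkey⟩
  refine ⟨N * (N₁ * N₂), hL, G, M₁' + M₂', ?_⟩
  have hm : MvPolynomial.aeval (fun i => exp ((1 / ((N * (N₁ * N₂) : ℕ) : ℚ)) • b i))
        (MvPolynomial.monomial (M₁' + M₂') (1 : k)) =
      MvPolynomial.aeval (fun i => exp ((1 / ((N * (N₁ * N₂) : ℕ) : ℚ)) • b i))
          (MvPolynomial.monomial M₁' (1 : k)) *
        MvPolynomial.aeval (fun i => exp ((1 / ((N * (N₁ * N₂) : ℕ) : ℚ)) • b i))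
          (MvPolynomial.monomial M₂' (1 : k)) := by
    rw [← map_mul, MvPolynomial.monomial_mul, one_mul]
  have hGev : MvPolynomial.aeval (fun i => exp ((1 / ((N * (N₁ * N₂) : ℕ) : ℚ)) • b i))
        (MvPolynomial.expand e₁ F₁) *
        MvPolynomial.aeval (fun i => exp ((1 / ((N * (N₁ * N₂) : ℕ) : ℚ)) • b i))
          (MvPolynomial.monomial M₂' (1 : k)) =
      MvPolynomial.aeval (fun i => exp ((1 / (N : ℚ)) • b i)) Q *
        MvPolynomial.aeval (fun i => exp ((1 / ((N * (N₁ * N₂) : ℕ) : ℚ)) • b i)) G := by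
    rw [← map_mul, hG, map_mul, hQ']
  linear_combination x * hm
    + MvPolynomial.aeval (fun i => exp ((1 / ((N * (N₁ * N₂) : ℕ) : ℚ)) • b i))
        (MvPolynomial.monomial M₂' (1 : k)) * h₁' + hGev

/-- **Denominators of semi-invariant fractions, raw form.**  For an exponential automorphism `σ`
mapping `k` into `k` and `Y''` into `Y''`, a reduced fraction `z = ev_N P / ev_N Q` with
`σ z = (c * exp y) * z` (`c ∈ k`, `y ∈ Y''`) satisfies
`(c * exp y) * σ (ev_N Q) * exp y₁ = ev_N Q * ev_L G` for some `y₁ ∈ Y''`, level `L` and polynomial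
`G` (the denominator ideal applied to `x = (c * exp y) * σ (ev_N Q)`, for which
`z * x = σ (ev_N P)`). [folklore] -/
theorem semiInvariant_denominator_rel (k : Subfield E) {Y' Y'' : Submodule ℚ E} {p : ℕ} (b : Fin p → E)
    (hbspan : ∀ y ∈ Y'', ∃ r : Fin p → ℚ, y - ∑ i, r i • b i ∈ Y') (hbY : ∀ i, b i ∈ Y'')
    (hexpY' : ∀ y ∈ Y', exp y ∈ k)
    (hAI : ∀ N : ℕ, 0 < N → AlgebraicIndependent k (fun i => exp ((1 / (N : ℚ)) • b i)))
    (hEC : ∀ {e : ℕ}, 0 < e → ∀ {P Q : MvPolynomial (Fin p) k}, IsRelPrime P Q →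
      IsRelPrime (MvPolynomial.expand e P) (MvPolynomial.expand e Q))
    (σ : E ≃+* E) (hσexp : ∀ x, σ (exp x) = exp (σ x))
    (hσk : ∀ z ∈ k, σ z ∈ k) (hσY'' : ∀ y ∈ Y'', σ y ∈ Y'')
    {N : ℕ} (hN : 0 < N) {z : E} {P Q : MvPolynomial (Fin p) k} (hrel : IsRelPrime P Q)
    (hz : z * MvPolynomial.aeval (fun i => exp ((1 / (N : ℚ)) • b i)) Q =
      MvPolynomial.aeval (fun i => exp ((1 / (N : ℚ)) • b i)) P)
    {c y : E} (hc : c ∈ k) (hy : y ∈ Y'') (hsemi : σ z = (c * exp y) * z) :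
    ∃ L : ℕ, 0 < L ∧ ∃ (G : MvPolynomial (Fin p) k) (y₁ : E), y₁ ∈ Y'' ∧
      (c * exp y) * σ (MvPolynomial.aeval (fun i => exp ((1 / (N : ℚ)) • b i)) Q) * exp y₁ =
        MvPolynomial.aeval (fun i => exp ((1 / (N : ℚ)) • b i)) Q *
          MvPolynomial.aeval (fun i => exp ((1 / (L : ℚ)) • b i)) G := by
  have hx : ∃ N₁ : ℕ, 0 < N₁ ∧ ∃ (F : MvPolynomial (Fin p) k) (M : Fin p →₀ ℕ),
      ((c * exp y) * σ (MvPolynomial.aeval (fun i => exp ((1 / (N : ℚ)) • b i)) Q)) *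
          MvPolynomial.aeval (fun i => exp ((1 / (N₁ : ℚ)) • b i)) (MvPolynomial.monomial M (1 : k)) =
        MvPolynomial.aeval (fun i => exp ((1 / (N₁ : ℚ)) • b i)) F :=
    exists_laurent_mul k b (exists_laurent_const_mul_exp k b hbspan hexpY' hc hy)
      (exists_laurent_map k b hbspan hbY hexpY' σ hσexp hσk hσY'' (exists_laurent_aeval k b hN Q))
  have heq : z * ((c * exp y) * σ (MvPolynomial.aeval (fun i => exp ((1 / (N : ℚ)) • b i)) Q)) =
      σ (MvPolynomial.aeval (fun i => exp ((1 / (N : ℚ)) • b i)) P) := by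
    rw [← hz, map_mul, hsemi]; ring
  have hzx : ∃ N₂ : ℕ, 0 < N₂ ∧ ∃ (F : MvPolynomial (Fin p) k) (M : Fin p →₀ ℕ),
      (z * ((c * exp y) * σ (MvPolynomial.aeval (fun i => exp ((1 / (N : ℚ)) • b i)) Q))) *
          MvPolynomial.aeval (fun i => exp ((1 / (N₂ : ℚ)) • b i)) (MvPolynomial.monomial M (1 : k)) =
        MvPolynomial.aeval (fun i => exp ((1 / (N₂ : ℚ)) • b i)) F := by
    rw [heq]
    exact exists_laurent_map k b hbspan hbY hexpY' σ hσexp hσk hσY'' (exists_laurent_aeval k b hN P)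
  obtain ⟨L, hL, G, M, h⟩ := laurent_mul_denominator k b hAI hEC hN hrel hz hx hzx
  obtain ⟨y₁, hy₁, hm⟩ := aeval_monomial_one_eq_exp k b hbY L M
  exact ⟨L, hL, G, y₁, hy₁, by rw [← hm, h]⟩

/-! ### Divisors of units of the Laurent ring -/

/-- **A polynomial value dividing a unit of the Laurent ring is a monomial.**  If
`ev_L G * u = exp y` with `u` a Laurent polynomial and `y ∈ Y''`, then `ev_L G = c * exp y'` with
`c ∈ kˣ` and `y' ∈ Y''` (clear denominators at a common level, use injectivity of `ev` and the fact
`hMD` that factors of monomials are monomials). [folklore] -/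
theorem aeval_eq_const_mul_exp_of_mul_laurent (k : Subfield E) {Y' Y'' : Submodule ℚ E} {p : ℕ}
    (b : Fin p → E) (hbspan : ∀ y ∈ Y'', ∃ r : Fin p → ℚ, y - ∑ i, r i • b i ∈ Y')
    (hbY : ∀ i, b i ∈ Y'') (hexpY' : ∀ y ∈ Y', exp y ∈ k)
    (hAI : ∀ N : ℕ, 0 < N → AlgebraicIndependent k (fun i => exp ((1 / (N : ℚ)) • b i)))
    (hMD : ∀ {f g : MvPolynomial (Fin p) k} {d : Fin p →₀ ℕ} {c : k}, c ≠ 0 →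
      f * g = MvPolynomial.monomial d c →
        ∃ (d' : Fin p →₀ ℕ) (c' : k), c' ≠ 0 ∧ f = MvPolynomial.monomial d' c')
    {L : ℕ} (hL : 0 < L) (G : MvPolynomial (Fin p) k) {u : E}
    (hu : ∃ N₁ : ℕ, 0 < N₁ ∧ ∃ (F : MvPolynomial (Fin p) k) (M : Fin p →₀ ℕ),
      u * MvPolynomial.aeval (fun i => exp ((1 / (N₁ : ℚ)) • b i)) (MvPolynomial.monomial M (1 : k)) =
        MvPolynomial.aeval (fun i => exp ((1 / (N₁ : ℚ)) • b i)) F)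
    {y : E} (hy : y ∈ Y'')
    (h : MvPolynomial.aeval (fun i => exp ((1 / (L : ℚ)) • b i)) G * u = exp y) :
    ∃ c ∈ k, c ≠ 0 ∧ ∃ y' ∈ Y'',
      MvPolynomial.aeval (fun i => exp ((1 / (L : ℚ)) • b i)) G = c * exp y' := by
  obtain ⟨N₁, hN₁, H, M₁, hH⟩ := hu
  obtain ⟨N₂, hN₂, Mp, Mm, c₂, hc₂, hexp⟩ := exists_laurent_exp k b hbspan hexpY' hy
  have he : 0 < N₁ * N₂ := Nat.mul_pos hN₁ hN₂
  have hΛ : 0 < L * (N₁ * N₂) := Nat.mul_pos hL he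
  obtain ⟨e₁, M₁', hH'⟩ := laurent_dvd k b hN₁ hΛ ((dvd_mul_right N₁ N₂).mul_left L) hH
  obtain ⟨e₂, Mm', hexp'⟩ := laurent_dvd k b hN₂ hΛ ((dvd_mul_left N₂ N₁).mul_left L) hexp
  rw [MvPolynomial.expand_monomial] at hexp'
  have hG' := aeval_expand k b hL he G
  -- identity in `k[X]` at level `Λ = L (N₁ N₂)`
  have hkey : MvPolynomial.expand (N₁ * N₂) G * (MvPolynomial.expand e₁ H * MvPolynomial.monomial Mm' 1) =
      MvPolynomial.monomial (e₂ • Mp + M₁') c₂ := by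
    apply aeval_injective k b hAI hΛ
    have hmon : MvPolynomial.monomial (e₂ • Mp + M₁') c₂ =
        MvPolynomial.monomial (e₂ • Mp) c₂ * MvPolynomial.monomial M₁' 1 := by
      rw [MvPolynomial.monomial_mul, mul_one]
    rw [map_mul, map_mul, hmon, map_mul, hG', ← hexp', ← hH', ← h]
    ring
  have hc₂' : c₂ ≠ 0 := fun h0 => hc₂ (by rw [h0, ZeroMemClass.coe_zero])
  obtain ⟨d', c', hc', hGd⟩ := hMD hc₂' hkey
  refine ⟨c', c'.2, fun h0 => hc' (ZeroMemClass.coe_eq_zero.mp h0), _,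
    expnt_mem b hbY (L * (N₁ * N₂)) d', ?_⟩
  rw [← hG', hGd, aeval_monomial_exp]

end CaseIICore

/-! ### The registered stub -/

/-- **Stub `stub_caseII_denominator` — the reduced denominator of a semi-invariant fraction is
semi-invariant.**  In the setting above let `θ` be an exponential ring automorphism of `E` with
`θ k = k` and `θ Y'' = Y''`, and let `z = ev_N P / ev_N Q` be a fraction in lowest terms
(`P`, `Q` coprime, `ev_N Q ≠ 0`) which is semi-invariant: `θ z = (c₀ * exp y₀) * z` with `c₀ ∈ kˣ`,
`y₀ ∈ Y''`.  Then `θ (ev_N Q) = (c * exp y) * ev_N Q` for some `c ∈ kˣ` and `y ∈ Y''`.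
Proof: the denominator ideal gives `w · θ (ev_N Q) · exp y₁ = ev_N Q · ev G₁` (`w = c₀ exp y₀`) and,
for `θ⁻¹`, `w' · θ⁻¹ (ev_N Q) · exp y₂ = ev_N Q · ev G₂`; applying `θ` to the latter and cancelling
`ev_N Q ≠ 0` yields `ev G₁ · θ (ev G₂) = exp (y₁ + θ y₂)`, so `ev G₁` divides a unit of the Laurent
ring and is a monomial `c' exp y'` (`hMD`), whence `θ (ev_N Q) = (c'/c₀) exp (y' - y₀ - y₁) · ev_N Q`.
[folklore] -/
theorem stub_caseII_denominator {E : Type*} [Field E] [CharZero E] [ExponentialRing E]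
    (k : Subfield E) {Y' Y'' : Submodule ℚ E} {p : ℕ} (b : Fin p → E)
    (hbspan : ∀ y ∈ Y'', ∃ r : Fin p → ℚ, y - ∑ i, r i • b i ∈ Y') (hbY : ∀ i, b i ∈ Y'')
    (hexpY' : ∀ y ∈ Y', exp y ∈ k)
    (hAI : ∀ N : ℕ, 0 < N → AlgebraicIndependent k (fun i => exp ((1 / (N : ℚ)) • b i)))
    (hEC : ∀ {e : ℕ}, 0 < e → ∀ {P Q : MvPolynomial (Fin p) k}, IsRelPrime P Q →
      IsRelPrime (MvPolynomial.expand e P) (MvPolynomial.expand e Q))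
    (hMD : ∀ {f g : MvPolynomial (Fin p) k} {d : Fin p →₀ ℕ} {c : k}, c ≠ 0 →
      f * g = MvPolynomial.monomial d c → ∃ (d' : Fin p →₀ ℕ) (c' : k), c' ≠ 0 ∧ f = MvPolynomial.monomial d' c')
    (θ : E ≃+* E) (hθexp : ∀ x, θ (exp x) = exp (θ x))
    (hθk : ∀ z, z ∈ k ↔ θ z ∈ k) (hθY'' : ∀ y, y ∈ Y'' ↔ θ y ∈ Y'')
    {N : ℕ} (hN : 0 < N) {z : E} {P Q : MvPolynomial (Fin p) k} (hrel : IsRelPrime P Q)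
    (hQ : MvPolynomial.aeval (fun i => exp ((1 / (N : ℚ)) • b i)) Q ≠ 0)
    (hz : z * MvPolynomial.aeval (fun i => exp ((1 / (N : ℚ)) • b i)) Q =
      MvPolynomial.aeval (fun i => exp ((1 / (N : ℚ)) • b i)) P)
    {c₀ y₀ : E} (hc₀ : c₀ ∈ k) (hc₀0 : c₀ ≠ 0) (hy₀ : y₀ ∈ Y'') (hsemi : θ z = (c₀ * exp y₀) * z) :
    ∃ c ∈ k, c ≠ 0 ∧ ∃ y ∈ Y'',
      θ (MvPolynomial.aeval (fun i => exp ((1 / (N : ℚ)) • b i)) Q) =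
        (c * exp y) * MvPolynomial.aeval (fun i => exp ((1 / (N : ℚ)) • b i)) Q := by
  -- `θ` and `θ⁻¹` stabilise `k` and `Y''` and commute with `exp`
  have hθkf : ∀ z ∈ k, θ z ∈ k := fun z hz => (hθk z).1 hz
  have hθY''f : ∀ y ∈ Y'', θ y ∈ Y'' := fun y hy => (hθY'' y).1 hy
  have hσexp : ∀ x, θ.symm (exp x) = exp (θ.symm x) := fun x =>
    θ.injective (by rw [hθexp, θ.apply_symm_apply, θ.apply_symm_apply])
  have hσk : ∀ z ∈ k, θ.symm z ∈ k := fun z hz => (hθk _).2 (by rwa [θ.apply_symm_apply])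
  have hσY'' : ∀ y ∈ Y'', θ.symm y ∈ Y'' := fun y hy => (hθY'' _).2 (by rwa [θ.apply_symm_apply])
  -- `z` is semi-invariant under `θ⁻¹`
  have hc₀σ : θ.symm c₀ ≠ 0 := (map_ne_zero θ.symm).2 hc₀0
  have hsemi' : θ.symm z = ((θ.symm c₀)⁻¹ * exp (-θ.symm y₀)) * z := by
    have h1 : (θ.symm c₀ * exp (θ.symm y₀)) * θ.symm z = z := by
      conv_rhs => rw [← θ.symm_apply_apply z]
      rw [hsemi, map_mul, map_mul, hσexp]
    conv_rhs => rw [← h1]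
    rw [show ((θ.symm c₀)⁻¹ * exp (-θ.symm y₀)) * ((θ.symm c₀ * exp (θ.symm y₀)) * θ.symm z) =
        ((θ.symm c₀)⁻¹ * θ.symm c₀) * (exp (θ.symm y₀) * exp (-θ.symm y₀)) * θ.symm z by ring,
      inv_mul_cancel₀ hc₀σ, exp_mul_exp_neg, one_mul, one_mul]
  -- (R1) and (R2): the denominator ideal for `θ` and for `θ⁻¹`
  obtain ⟨L₁, hL₁, G₁, y₁, hy₁, hR1⟩ := CaseIICore.semiInvariant_denominator_rel k b hbspan hbY hexpY'
    hAI hEC θ hθexp hθkf hθY''f hN hrel hz hc₀ hy₀ hsemi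
  obtain ⟨L₂, hL₂, G₂, y₂, hy₂, hR2⟩ := CaseIICore.semiInvariant_denominator_rel k b hbspan hbY hexpY'
    hAI hEC θ.symm hσexp hσk hσY'' hN hrel hz (inv_mem (hσk c₀ hc₀)) (Y''.neg_mem (hσY'' y₀ hy₀)) hsemi'
  -- (R3): apply `θ` to (R2)
  have hR3 := congrArg θ hR2
  simp only [map_mul, map_inv₀, hθexp, map_neg, RingEquiv.apply_symm_apply] at hR3
  set evQ := MvPolynomial.aeval (fun i => exp ((1 / (N : ℚ)) • b i)) Q
  set evG₁ := MvPolynomial.aeval (fun i => exp ((1 / (L₁ : ℚ)) • b i)) G₁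
  set evG₂ := MvPolynomial.aeval (fun i => exp ((1 / (L₂ : ℚ)) • b i)) G₂
  -- cancel `ev_N Q`: `ev G₁ * θ (ev G₂)` is a unit of the Laurent ring
  have hunit : evG₁ * θ evG₂ = exp (y₁ + θ y₂) := by
    apply mul_left_cancel₀ hQ
    have hcc : c₀ * c₀⁻¹ = 1 := mul_inv_cancel₀ hc₀0
    have hee : exp y₀ * exp (-y₀) = 1 := exp_mul_exp_neg y₀
    calc evQ * (evG₁ * θ evG₂) = ((c₀ * exp y₀) * θ evQ * exp y₁) * θ evG₂ := by rw [hR1]; ring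
      _ = (c₀ * exp y₀) * exp y₁ * (θ evQ * θ evG₂) := by ring
      _ = (c₀ * exp y₀) * exp y₁ * (c₀⁻¹ * exp (-y₀) * evQ * exp (θ y₂)) := by rw [hR3]
      _ = (c₀ * c₀⁻¹) * (exp y₀ * exp (-y₀)) * (evQ * (exp y₁ * exp (θ y₂))) := by ring
      _ = evQ * exp (y₁ + θ y₂) := by rw [hcc, hee, one_mul, one_mul, exp_add]
  have hu : ∃ N' : ℕ, 0 < N' ∧ ∃ (F : MvPolynomial (Fin p) k) (M : Fin p →₀ ℕ),
      θ evG₂ * MvPolynomial.aeval (fun i => exp ((1 / (N' : ℚ)) • b i)) (MvPolynomial.monomial M (1 : k)) =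
        MvPolynomial.aeval (fun i => exp ((1 / (N' : ℚ)) • b i)) F :=
    CaseIICore.exists_laurent_map k b hbspan hbY hexpY' θ hθexp hθkf hθY''f
      (CaseIICore.exists_laurent_aeval k b hL₂ G₂)
  obtain ⟨c', hc'k, hc'0, y', hy', hG₁⟩ : ∃ c ∈ k, c ≠ 0 ∧ ∃ y' ∈ Y'', evG₁ = c * exp y' :=
    CaseIICore.aeval_eq_const_mul_exp_of_mul_laurent k b hbspan hbY hexpY' hAI hMD hL₁ G₁ hu
      (Y''.add_mem hy₁ (hθY''f y₂ hy₂)) hunit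
  -- (R4): read off `θ (ev_N Q)` from (R1)
  rw [hG₁] at hR1
  refine ⟨c' * c₀⁻¹, mul_mem hc'k (inv_mem hc₀), mul_ne_zero hc'0 (inv_ne_zero hc₀0), y' - y₀ - y₁,
    Y''.sub_mem (Y''.sub_mem hy' hy₀) hy₁, ?_⟩
  calc θ evQ = (c₀ * c₀⁻¹) * (exp y₀ * exp (-y₀)) * (exp y₁ * exp (-y₁)) * θ evQ := by
        rw [mul_inv_cancel₀ hc₀0, exp_mul_exp_neg, exp_mul_exp_neg, one_mul, one_mul, one_mul]
    _ = ((c₀ * exp y₀) * θ evQ * exp y₁) * (c₀⁻¹ * (exp (-y₀) * exp (-y₁))) := by ring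
    _ = evQ * (c' * exp y') * (c₀⁻¹ * (exp (-y₀) * exp (-y₁))) := by rw [hR1]
    _ = (c' * c₀⁻¹ * exp (y' - y₀ - y₁)) * evQ := by
        rw [sub_eq_add_neg, sub_eq_add_neg, exp_add, exp_add]; ring

end Summit.Schanuel.Schanuel.Theorems.RigidCore
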